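import Summits.Parity.GeneralizedHardyLittlewood.Theorems.Dhl42KernelH
import Summits.Parity.GeneralizedHardyLittlewood.Theorems.Dhl42KernelI
import Summits.Parity.GeneralizedHardyLittlewood.Theorems.Dhl42KernelJ2
import Summits.Parity.GeneralizedHardyLittlewood.Theorems.Dhl42MainTerms

/-!
# DHL[42,2] certificate — from the kernel computations to `pairedI = iSum` and `pairedJ = jkSum`

Glue: the kernel's checkpoint equations (`Dhl42KernelH`), the pairing evaluations (`Dhl42KernelI`,
`Dhl42KernelJ1/2`) and their totals (`Itot`, `Jtot`) are combined, through the denotational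
congruence lemmas of the tree's `ExpPoly` (`EP.eval_eq_of_canon_eq`, `EP.convIter_add`,
`EP.eval_convIter_congr`) and of `Dhl42ClosedFormSetup`, into the equality of the explicit real
numbers `pairedI`, `pairedJ` (no literals) with the exact values `iSum`, `jkSum` of
`Dhl42MainTerms`. No kernel computation happens in this file.

Origin: `Dhl42/ClosedForm/KernelBridge.lean` of the DHL[42,2] certificate package (pub-dhl42 bundle,
archive blob `18cce9e3`; sha256[:16] of the file `ca37c593d5e2c41b`; paper snapshot =
`paper/main.tex` v1), lines :22–:88; statements and proofs unchanged except: namespace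
`Dhl42.ClosedForm` → `Summit.Parity.GeneralizedHardyLittlewood.Theorems.Dhl42.ClosedForm`,
`Dhl42.ExpPoly` → the tree's `Literature.Analysis.ValidatedNumerics.ExpPoly` (`ExpPoly/*.lean`,
batch B1), `Dhl42.iSum` / `Dhl42.jkSum` resolve to
`Summit.Parity.GeneralizedHardyLittlewood.Theorems.Dhl42.iSum` / `.jkSum` unchanged
(`Dhl42MainTerms`, B4a), docstrings added where missing.

Declarations (8): `eval_convIter_canon`, `eval_conv_canon`, `eval_D39`, `eval_D40`, `eval_D41`,
`eval_D42`, `pairedI_eq_iSum`, `pairedJ_eq_jkSum`.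
-/

open Real
open Literature.Analysis.ValidatedNumerics.ExpPoly

namespace Summit.Parity.GeneralizedHardyLittlewood.Theorems.Dhl42.ClosedForm

/-! ### The densities `D42`, `D41`, `D40`, `D39` have the evaluations of the literals -/

/-- Gluing of checkpoints: if the canonical form of `f^{⋆n} ⋆ L` is `M`, then
`⟦f^{⋆(m+n)} ⋆ L⟧ = ⟦f^{⋆m} ⋆ M⟧` as functions — evaluation factors through canonical forms
(`EP.eval_eq_of_canon_eq`) and convolution respects equality of evaluations
(`EP.eval_convIter_congr`). -/
theorem eval_convIter_canon {f : ES} {n : ℕ} {L M : EP} (h : EP.canon (EP.convIter f n L) = M) (m : ℕ) :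
    EP.eval (EP.convIter f (m + n) L) = EP.eval (EP.convIter f m M) := by
  rw [EP.convIter_add]; exact EP.eval_convIter_congr f m (EP.eval_eq_of_canon_eq h)

/-- The case `n = 1` of `eval_convIter_canon`: one convolution step read through its canonical form.
-/
theorem eval_conv_canon {f : ES} {L M : EP} (h : EP.canon (EP.conv f L) = M) (m : ℕ) :
    EP.eval (EP.convIter f (m + 1) L) = EP.eval (EP.convIter f m M) :=
  eval_convIter_canon (n := 1) h m

/-- `⟦GE^{⋆38} ⋆ GE⟧ = ⟦H39⟧`: the density `G^{⋆39}` (`J`-side pairing 4) has the evaluation of the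
literal `H39` — checkpoints `seg26`, `seg33`, `seg39` glued along `38 = 6 + 7 + 25`. -/
theorem eval_D39 : EP.eval (EP.convIter GE 38 (ES.toEP GE)) = EP.eval H39 := by
  rw [show (38 : ℕ) = (6 + 7) + 25 from rfl, eval_convIter_canon seg26, eval_convIter_canon seg33,
    show (6 : ℕ) = 0 + 6 from rfl, eval_convIter_canon seg39]
  rfl

/-- `⟦D40⟧ = ⟦H40⟧`: the density `G^{⋆40}` has the evaluation of the literal `H40` (checkpoints
`seg26` … `seg40`). -/
theorem eval_D40 : EP.eval D40 = EP.eval H40 := by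
  rw [D40, show (39 : ℕ) = ((1 + 6) + 7) + 25 from rfl, eval_convIter_canon seg26,
    eval_convIter_canon seg33, eval_convIter_canon seg39, show (1 : ℕ) = 0 + 1 from rfl,
    eval_conv_canon seg40]
  rfl

/-- `⟦D41⟧ = ⟦H41⟧`: the density `G^{⋆41}` has the evaluation of the literal `H41` (checkpoints
`seg26` … `seg41`). -/
theorem eval_D41 : EP.eval D41 = EP.eval H41 := by
  rw [D41, show (40 : ℕ) = (((2 + 6) + 7) + 25) from rfl, eval_convIter_canon seg26,
    eval_convIter_canon seg33, eval_convIter_canon seg39, show (2 : ℕ) = 1 + 1 from rfl,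
    eval_conv_canon seg40, show (1 : ℕ) = 0 + 1 from rfl, eval_conv_canon seg41]
  rfl

/-- `⟦D42⟧ = ⟦H42⟧`: the density `G^{⋆42}` has the evaluation of the literal `H42` (checkpoints
`seg26` … `seg42`). -/
theorem eval_D42 : EP.eval D42 = EP.eval H42 := by
  rw [D42, show (41 : ℕ) = (((3 + 6) + 7) + 25) from rfl, eval_convIter_canon seg26,
    eval_convIter_canon seg33, eval_convIter_canon seg39, show (3 : ℕ) = 2 + 1 from rfl,
    eval_conv_canon seg40, show (2 : ℕ) = 1 + 1 from rfl, eval_conv_canon seg41,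
    show (1 : ℕ) = 0 + 1 from rfl, eval_conv_canon seg42]
  rfl

/-! ### `pairedI = iSum` -/

/-- **`pairedI = iSum`** (§6.3 for `I(F₀)`): the explicit closed form `pairedI` of
`Dhl42ClosedFormSetup` (class pairings with multiplicities `1, 84, 42, 1722`; no literals) equals
the exact 23-term value `iSum` of `Dhl42MainTerms` — each pairing is transported to the literal
density by the congruence lemmas (`eval_pairLoHi_congr`, `eval_pairLo_congr`, `eval_canon_conv`) and
evaluated by the kernel (`pI1` … `pI4`), and the total is the kernel identity `Itot` read through
`esum_eq_eval_etermsFS`. -/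
theorem pairedI_eq_iSum : pairedI = Dhl42.iSum := by
  have h1 : FS.eval (pairLoHi D42 WPhi2lo WPhi2hi) = FS.eval FI1 := by
    rw [eval_pairLoHi_congr eval_D42, eval_of_norm_eq pI1]
  have h2 : FS.eval (pairLo (EP.conv GHE D41) WPhichi) = FS.eval FI2 := by
    rw [eval_pairLo_congr (eval_canon_conv GHE eval_D41), eval_of_norm_eq pI2]
  have h3 : FS.eval (pairLo (EP.conv H2E D41) Wchi2) = FS.eval FI3 := by
    rw [eval_pairLo_congr (eval_canon_conv H2E eval_D41), eval_of_norm_eq pI3]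
  have h4 : FS.eval (pairLo (EP.conv GHE (EP.conv GHE D40)) Wchi2) = FS.eval FI4 := by
    rw [eval_pairLo_congr (eval_canon_conv GHE (eval_canon_conv GHE eval_D40)), eval_of_norm_eq pI4]
  rw [pairedI, h1, h2, h3, h4, Dhl42.iSum, esum_eq_eval_etermsFS, ← FS.eval_norm (etermsFS _), ← Itot,
    FS.eval_norm]
  simp only [FS.eval_append, FS.eval_smul]
  push_cast; ring

/-! ### `pairedJ = jkSum` -/

/-- **`pairedJ = jkSum`** (§6.3 for `42·J^K(F₀)`): the explicit closed form `pairedJ` (class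
pairings with multiplicities `42·(1, 82, 41, 1640)`) equals the exact 113-term value `jkSum` of
`Dhl42MainTerms` — by the kernel evaluations `pJ1` … `pJ4` transported along `eval_D39` …
`eval_D41`, and the kernel identity `Jtot`. -/
theorem pairedJ_eq_jkSum : pairedJ = Dhl42.jkSum := by
  have h1 : FS.eval (pairLo D41 WP2) = FS.eval FJ1all := by
    rw [eval_pairLo_congr eval_D41, pJ1]
  have h2 : FS.eval (pairLo (EP.conv GHE D40) WPQ) = FS.eval FJ2all := by
    rw [eval_pairLo_congr (eval_canon_conv GHE eval_D40), pJ2]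
  have h3 : FS.eval (pairLo (EP.conv H2E D40) WQ2) = FS.eval FJ3all := by
    rw [eval_pairLo_congr (eval_canon_conv H2E eval_D40), pJ3]
  have h4 : FS.eval (pairLo (EP.conv GHE (EP.conv GHE (EP.convIter GE 38 (ES.toEP GE)))) WQ2) =
      FS.eval FJ4all := by
    rw [eval_pairLo_congr (eval_canon_conv GHE (eval_canon_conv GHE eval_D39)), pJ4]
  rw [pairedJ, h1, h2, h3, h4, Dhl42.jkSum, esum_eq_eval_etermsFS, ← FS.eval_norm (etermsFS _), ← Jtot,
    FS.eval_norm]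
  simp only [FS.eval_append, FS.eval_smul]
  push_cast; ring

end Summit.Parity.GeneralizedHardyLittlewood.Theorems.Dhl42.ClosedForm
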